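import Summits.CriticalPhenomena.PercolationContinuityZ3.Theorems.PercNearOneGluingNoHeavyLowerTailFaceCDAtoms
import HarnessLib

/-!
# `NoHeavyLowerTail` (stmt-CriticalPhenomena-4575) — the FORMAL FACE of the `2 + (any law)` kernel in REGIME D and the resulting kernel

Support file (lemma factory `prim-lf-3` gen 11, seat g11; `--supports stmt-CriticalPhenomena-4575`).  No definitions, no named
facts, no sorries.  Memo: `run/shared/lean/prim/prim-lf-3/LF3-BETA-R.md` §16a.

Setting of `twoPortSide_reduction` / `face_regimeB`: core `K` with `o` isolated, two-port star `{c, d}`, arbitrary law `ν ≥ 0` on the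
subsets of the port set `Q` of the second unit, `u ∈ [0,1]`, forced-star margins `G`, witness `j`.  REGIME D of the memo: the glued pair
beats `j` (`μ_{K[cd↦1]}(jb) ≤ μ_{K[cd↦1]}(cb)`, i.e. `α_P ≥ 0`) and `j` is below every port of `Q` in the mixture `K_u = (1−u)K + uK[cd↦1]`.

* `face_regimeD` — the face `Σ_Y ν(Y)[(1−u) G'(Y) + u G(Y ∪ {c,d})]` is nonnegative for EVERY `ν ≥ 0`, with no row at all
  (atomwise `f_Y ≥ 0`, `faceD_atom`).
* `twoPlusLaw_regimeD` — with `twoPortSide_reduction`: the `2 + (law ν)` kernel `F ≥ 0` from the split rows of `c`, `d`.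
-/

namespace Summit.CriticalPhenomena.PercolationContinuityZ3.Theorems

open MeasureTheory Set ProbabilityTheory
open Literature.Probability.LatticeModels
open Literature.Probability.Percolation

noncomputable section
open Classical

namespace UpsetExchange

variable {n : ℕ}

/-- **The formal face in regime D** (the glued pair beats `j`, every port of `Q` beats `j` in `K_u`): the face is nonnegative
for every law `ν ≥ 0`, with no row at all. [cite: KozmaNitzan2024, Question 9 (p. 36), Lemma 5 (p. 13), Lemma 3(i) (p. 6)] -/
theorem face_regimeD (K : Sym2 (Fin n) → unitInterval) (o c d j b : Fin n) (Q : Finset (Fin n))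
    (ν : Finset (Fin n) → ℝ) (hν : ∀ S ∈ Q.powerset, 0 ≤ ν S) (u : unitInterval)
    (hoQ : o ∉ Q) (hcQ : c ∉ Q) (hdQ : d ∉ Q) (hbQ : b ∉ Q) (hcd : c ≠ d) (hoc : o ≠ c) (hod : o ≠ d) (hjo : j ≠ o) (hbo : b ≠ o)
    (hisoK : ∀ u' : Fin n, u' ≠ o → K s(o, u') = 0)
    (G : Finset (Fin n) → ℝ)
    (hG : ∀ T : Finset (Fin n), G T =
      (prodBernoulli (fun f : Sym2 (Fin n) => if f ∈ T.image (fun t => s(o, t)) then 1 else K f)).real (openConn o b) -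
        (prodBernoulli (fun f : Sym2 (Fin n) => if f ∈ T.image (fun t => s(o, t)) then 1 else K f)).real (openConn j b))
    (hcb : c ≠ b)
    (hB0 : (prodBernoulli (fun f : Sym2 (Fin n) => if f = s(c, d) then 1 else K f)).real (openConn j b) ≤
      (prodBernoulli (fun f : Sym2 (Fin n) => if f = s(c, d) then 1 else K f)).real (openConn c b))
    (hjmin : ∀ y ∈ Q, (1 - (u : ℝ)) * (prodBernoulli K).real (openConn j b) +
        (u : ℝ) * (prodBernoulli (fun f : Sym2 (Fin n) => if f = s(c, d) then 1 else K f)).real (openConn j b) ≤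
      (1 - (u : ℝ)) * (prodBernoulli K).real (openConn y b) +
        (u : ℝ) * (prodBernoulli (fun f : Sym2 (Fin n) => if f = s(c, d) then 1 else K f)).real (openConn y b)) :
    0 ≤ ∑ Y ∈ Q.powerset, ν Y * ((1 - (u : ℝ)) * (if Y = ∅ then 0 else G Y) + (u : ℝ) * G (insert c (insert d Y))) := by
  have hu0 : 0 ≤ (u : ℝ) := unitInterval.nonneg u
  have hu1 : 0 ≤ 1 - (u : ℝ) := sub_nonneg.2 (unitInterval.le_one u)
  set e : Sym2 (Fin n) := s(c, d) with he
  -- the atom inequality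
  have key : ∀ Y ∈ Q.powerset,
      0 ≤ (1 - (u : ℝ)) * (if Y = ∅ then 0 else G Y) + (u : ℝ) * G (insert c (insert d Y)) := by
    intro Y hY
    have hYQ : Y ⊆ Q := Finset.mem_powerset.1 hY
    have hcY : c ∉ Y := fun h => hcQ (hYQ h)
    have hdY : d ∉ Y := fun h => hdQ (hYQ h)
    have hbY : b ∉ Y := fun h => hbQ (hYQ h)
    have hoY : o ∉ Y := fun h => hoQ (hYQ h)
    by_cases hYe : Y = ∅
    · -- the empty atom: `α_P ≥ 0`
      subst hYe
      rw [if_pos rfl]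
      -- `G {c, d}` through the sure pair `e`
      have hocd : o ∉ ({c, d} : Finset (Fin n)) := by
        simp only [Finset.mem_insert, Finset.mem_singleton, not_or]; exact ⟨hoc, hod⟩
      have hreach : ∀ t ∈ ({c, d} : Finset (Fin n)), t = c ∨ s(c, t) ∈ ({e} : Finset (Sym2 (Fin n))) ∨
          ∃ m : Fin n, m ≠ c ∧ m ≠ t ∧ s(m, c) ∈ ({e} : Finset (Sym2 (Fin n))) ∧ s(m, t) ∈ ({e} : Finset (Sym2 (Fin n))) := by
        intro t ht
        simp only [Finset.mem_insert, Finset.mem_singleton] at ht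
        rcases ht with rfl | rfl
        · exact Or.inl rfl
        · exact Or.inr (Or.inl (Finset.mem_singleton_self _))
      have hSin : ∀ f ∈ ({e} : Finset (Sym2 (Fin n))), ∀ x ∈ f, x ∈ ({c, d} : Finset (Fin n)) := by
        intro f hf x hx
        rw [Finset.mem_singleton] at hf; subst hf
        rcases Sym2.mem_iff.1 hx with rfl | rfl <;> simp
      have hGcd := forcedMargin_eq K o b j hisoK hbo hjo {c, d} hocd c (by simp) {e} hSin hreach
      have hfe : (fun f : Sym2 (Fin n) => if f ∈ ({e} : Finset (Sym2 (Fin n))) then (1 : unitInterval) else K f) =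
          fun f => if f = s(c, d) then 1 else K f := by
        funext f; simp only [Finset.mem_singleton, he]
      have hins : insert c (insert d (∅ : Finset (Fin n))) = {c, d} := by rw [Finset.insert_empty]
      rw [hins, hG {c, d}, hGcd, hfe]
      nlinarith [hB0, hu0, hu1]
    · -- a nonempty atom: `faceD_atom` with `s₀ ∈ Y`
      rw [if_neg hYe]
      obtain ⟨s₀, hs₀⟩ := Finset.nonempty_iff_ne_empty.2 hYe
      have hatom := faceD_atom K Y c d j b s₀ s₀ u hs₀ hs₀ hcY hdY hbY hcd hcb hB0 (hjmin s₀ (hYQ hs₀))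
      -- `G Y` through the clique of `Y`
      set C₁ : Finset (Sym2 (Fin n)) := Finset.univ.filter (fun f : Sym2 (Fin n) => (∀ x ∈ f, x ∈ Y) ∧ ¬ f.IsDiag) with hC₁
      have hreach₁ : ∀ t ∈ Y, t = s₀ ∨ s(s₀, t) ∈ C₁ ∨ ∃ m : Fin n, m ≠ s₀ ∧ m ≠ t ∧ s(m, s₀) ∈ C₁ ∧ s(m, t) ∈ C₁ := by
        intro t ht
        by_cases hts : t = s₀
        · exact Or.inl hts
        · refine Or.inr (Or.inl (Finset.mem_filter.2 ⟨Finset.mem_univ _, ?_, ?_⟩))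
          · intro x hx; rcases Sym2.mem_iff.1 hx with rfl | rfl; exact hs₀; exact ht
          · rw [Sym2.mk_isDiag_iff]; exact fun h => hts h.symm
      have hG₁ := forcedMargin_eq K o b j hisoK hbo hjo Y hoY s₀ hs₀ C₁ (cliquePairs_mem_inside Y) hreach₁
      have hf₁ := glueClique_eq_memForm K Y
      -- `G (insert c (insert d Y))` through the clique of `Y` plus the pairs `cd`, `c s₀`
      set T₂ : Finset (Fin n) := insert c (insert d Y) with hT₂
      set C₂ : Finset (Sym2 (Fin n)) := insert s(c, s₀) (insert e C₁) with hC₂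
      have hcs₀ : c ≠ s₀ := fun h => hcY (h ▸ hs₀)
      have hoT₂ : o ∉ T₂ := by
        rw [hT₂, Finset.mem_insert, Finset.mem_insert]; rintro (h | h | h); exact hoc h; exact hod h; exact hoY h
      have hcT₂ : c ∈ T₂ := Finset.mem_insert_self _ _
      have hC₂in : ∀ f ∈ C₂, ∀ x ∈ f, x ∈ T₂ := by
        intro f hf x hx
        rw [hC₂, Finset.mem_insert, Finset.mem_insert] at hf
        rcases hf with rfl | rfl | hf
        · rcases Sym2.mem_iff.1 hx with rfl | rfl
          · exact hcT₂
          · exact Finset.mem_insert_of_mem (Finset.mem_insert_of_mem hs₀)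
        · rcases Sym2.mem_iff.1 hx with rfl | rfl
          · exact hcT₂
          · exact Finset.mem_insert_of_mem (Finset.mem_insert_self _ _)
        · exact Finset.mem_insert_of_mem (Finset.mem_insert_of_mem (cliquePairs_mem_inside Y f hf x hx))
      have hreach₂ : ∀ t ∈ T₂, t = c ∨ s(c, t) ∈ C₂ ∨ ∃ m : Fin n, m ≠ c ∧ m ≠ t ∧ s(m, c) ∈ C₂ ∧ s(m, t) ∈ C₂ := by
        intro t ht
        rw [hT₂, Finset.mem_insert, Finset.mem_insert] at ht
        rcases ht with rfl | rfl | ht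
        · exact Or.inl rfl
        · exact Or.inr (Or.inl (by rw [hC₂]; exact Finset.mem_insert_of_mem (Finset.mem_insert_self _ _)))
        · by_cases hts : t = s₀
          · subst hts; exact Or.inr (Or.inl (by rw [hC₂]; exact Finset.mem_insert_self _ _))
          · refine Or.inr (Or.inr ⟨s₀, hcs₀.symm, fun h => hts h.symm, ?_, ?_⟩)
            · rw [hC₂, Sym2.eq_swap]; exact Finset.mem_insert_self _ _
            · rw [hC₂]
              refine Finset.mem_insert_of_mem (Finset.mem_insert_of_mem (Finset.mem_filter.2 ⟨Finset.mem_univ _, ?_, ?_⟩))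
              · intro x hx; rcases Sym2.mem_iff.1 hx with rfl | rfl; exact hs₀; exact ht
              · rw [Sym2.mk_isDiag_iff]; exact fun h => hts h.symm
      have hG₂ := forcedMargin_eq K o b j hisoK hbo hjo T₂ hoT₂ c hcT₂ C₂ hC₂in hreach₂
      have hecs : s(c, s₀) ≠ e := by
        rw [he]; intro h
        have : s₀ ∈ s(c, d) := h ▸ Sym2.mem_mk_right c s₀
        rcases Sym2.mem_iff.1 this with h1 | h1
        · exact hcs₀ h1.symm
        · exact hdY (h1 ▸ hs₀)
      have heC₁ : e ∉ C₁ := fun h => hcY ((Finset.mem_filter.1 h).2.1 c (by rw [he]; exact Sym2.mem_mk_left c d))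
      have hsC₁ : s(c, s₀) ∉ C₁ := fun h => hcY ((Finset.mem_filter.1 h).2.1 c (Sym2.mem_mk_left c s₀))
      have hf₂ : (fun f : Sym2 (Fin n) => if f = s(c, s₀) then (1 : unitInterval) else (if f = s(c, d) then 1 else
          (if (∀ x ∈ f, x ∈ Y) ∧ ¬ f.IsDiag then 1 else K f))) = fun f => if f ∈ C₂ then 1 else K f := by
        funext f
        rw [congrFun hf₁ f]
        by_cases h1 : f = s(c, s₀)
        · have : f ∈ C₂ := by rw [hC₂, h1]; exact Finset.mem_insert_self _ _
          rw [if_pos h1, if_pos this]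
        · rw [if_neg h1]
          by_cases h2 : f = s(c, d)
          · have : f ∈ C₂ := by rw [hC₂, h2]; exact Finset.mem_insert_of_mem (Finset.mem_insert_self _ _)
            rw [if_pos h2, if_pos this]
          · rw [if_neg h2]
            by_cases h3 : f ∈ C₁
            · have : f ∈ C₂ := by rw [hC₂]; exact Finset.mem_insert_of_mem (Finset.mem_insert_of_mem h3)
              rw [if_pos h3, if_pos this]
            · have : f ∉ C₂ := by
                rw [hC₂, Finset.mem_insert, Finset.mem_insert]
                rintro (h | h | h); exact h1 h; exact h2 (h.trans he.symm); exact h3 h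
              rw [if_neg h3, if_neg this]
      rw [hG Y, hG T₂, hG₁, hG₂, ← hf₁, ← hf₂]
      linarith [hatom]
  exact Finset.sum_nonneg fun Y hY => mul_nonneg (hν Y hY) (key Y hY)

/-- **The `2 + (any law)` kernel in regime D** (= `face_regimeD` + `twoPortSide_reduction`). [cite: KozmaNitzan2024, Question 9 (p. 36), Lemma 5 (p. 13)] -/
theorem twoPlusLaw_regimeD (K : Sym2 (Fin n) → unitInterval) (o c d j b : Fin n) (Q : Finset (Fin n))
    (ν : Finset (Fin n) → ℝ) (hν : ∀ S ∈ Q.powerset, 0 ≤ ν S) (u : unitInterval) {h₁ h₂ : ℝ}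
    (hh₁ : 0 < h₁) (hh₁' : h₁ ≤ 1) (hh₂ : 0 < h₂) (hh₂' : h₂ ≤ 1) (hprod : h₁ * h₂ = u) (hu1 : (u : ℝ) < 1)
    (hoQ : o ∉ Q) (hcQ : c ∉ Q) (hdQ : d ∉ Q) (hbQ : b ∉ Q) (hcd : c ≠ d) (hoc : o ≠ c) (hod : o ≠ d) (hjo : j ≠ o) (hbo : b ≠ o)
    (hisoK : ∀ u' : Fin n, u' ≠ o → K s(o, u') = 0)
    (G : Finset (Fin n) → ℝ)
    (hG : ∀ T : Finset (Fin n), G T =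
      (prodBernoulli (fun f : Sym2 (Fin n) => if f ∈ T.image (fun t => s(o, t)) then 1 else K f)).real (openConn o b) -
        (prodBernoulli (fun f : Sym2 (Fin n) => if f ∈ T.image (fun t => s(o, t)) then 1 else K f)).real (openConn j b))
    (hcb : c ≠ b)
    (hB0 : (prodBernoulli (fun f : Sym2 (Fin n) => if f = s(c, d) then 1 else K f)).real (openConn j b) ≤
      (prodBernoulli (fun f : Sym2 (Fin n) => if f = s(c, d) then 1 else K f)).real (openConn c b))
    (hjmin : ∀ y ∈ Q, (1 - (u : ℝ)) * (prodBernoulli K).real (openConn j b) +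
        (u : ℝ) * (prodBernoulli (fun f : Sym2 (Fin n) => if f = s(c, d) then 1 else K f)).real (openConn j b) ≤
      (1 - (u : ℝ)) * (prodBernoulli K).real (openConn y b) +
        (u : ℝ) * (prodBernoulli (fun f : Sym2 (Fin n) => if f = s(c, d) then 1 else K f)).real (openConn y b))
    (hrowc : 0 ≤ ∑ S ∈ Q.powerset, ν S *
      ((1 - (u : ℝ)) * ((prodBernoulli (fun e : Sym2 (Fin n) => if (∀ x ∈ e, x ∈ S) ∧ ¬ e.IsDiag then 1 else K e)).real (openConn c b) -
          (prodBernoulli (fun e : Sym2 (Fin n) => if (∀ x ∈ e, x ∈ S) ∧ ¬ e.IsDiag then 1 else K e)).real (openConn j b)) +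
        (u : ℝ) * ((prodBernoulli (fun f : Sym2 (Fin n) => if f = s(c, d) then 1 else
              (if (∀ x ∈ f, x ∈ S) ∧ ¬ f.IsDiag then 1 else K f))).real (openConn c b) -
          (prodBernoulli (fun f : Sym2 (Fin n) => if f = s(c, d) then 1 else
              (if (∀ x ∈ f, x ∈ S) ∧ ¬ f.IsDiag then 1 else K f))).real (openConn j b))))
    (hrowd : 0 ≤ ∑ S ∈ Q.powerset, ν S *
      ((1 - (u : ℝ)) * ((prodBernoulli (fun e : Sym2 (Fin n) => if (∀ x ∈ e, x ∈ S) ∧ ¬ e.IsDiag then 1 else K e)).real (openConn d b) -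
          (prodBernoulli (fun e : Sym2 (Fin n) => if (∀ x ∈ e, x ∈ S) ∧ ¬ e.IsDiag then 1 else K e)).real (openConn j b)) +
        (u : ℝ) * ((prodBernoulli (fun f : Sym2 (Fin n) => if f = s(d, c) then 1 else
              (if (∀ x ∈ f, x ∈ S) ∧ ¬ f.IsDiag then 1 else K f))).real (openConn d b) -
          (prodBernoulli (fun f : Sym2 (Fin n) => if f = s(d, c) then 1 else
              (if (∀ x ∈ f, x ∈ S) ∧ ¬ f.IsDiag then 1 else K f))).real (openConn j b)))) :
    0 ≤ ∑ Y ∈ Q.powerset, ν Y *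
        ((1 - h₁) * (1 - h₂) * (if Y = ∅ then 0 else G Y) + (1 - h₁) * h₂ * G (insert d Y) +
          h₁ * (1 - h₂) * G (insert c Y) + h₁ * h₂ * G (insert c (insert d Y))) :=
  twoPortSide_reduction K o c d j b Q ν hν u hh₁ hh₁' hh₂ hh₂' hprod hu1 hoQ hcQ hdQ hcd hoc hod hjo hbo hisoK G hG hrowc hrowd
    (face_regimeD K o c d j b Q ν hν u hoQ hcQ hdQ hbQ hcd hoc hod hjo hbo hisoK G hG hcb hB0 hjmin)


end UpsetExchange

end

end Summit.CriticalPhenomena.PercolationContinuityZ3.Theorems
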